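import Literature.AnabelianGeometry.AbsoluteAnabelian.AbsTopII.TwoTripodNodalEdgePairs
import HarnessLib

/-!
# [AbsTopII] Prop 1.3 (viii) at the two-vertex nodal datum, III: the typed `Prop_1_3_viii'`, modulo the inertia key

S. Mochizuki, *Topics in Absolute Anabelian Geometry II* [AbsTopII] (bib `MochizukiAbsTopII2013`; locators =
PDF pages of the kurims manuscript `paper:url-585b8d0ad0d9`), §1 Prop 1.3 (viii) p. 12:

> "(viii) Let `e, e'` be edges of `𝔾`.  If `D_e ∩ D_{e'} ∩ Π_I ≠ {1}`, then one of the following two [mutually exclusive]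
> properties holds: (1) `e = e'`; (2) `e` and `e'` are distinct, but abut to the same vertex `v`, and
> `D_e ∩ D_{e'} ∩ Π_𝔾 = {1}`.  Moreover, in the situation of (2), [for appropriate choices of conjugates of the various
> inertia and decomposition groups involved] we have `I_v = D_e ∩ D_{e'} ∩ Π_I`."

PROOF-ONLY companion of `AbsTopII/TwoTripodNodalDatum.lean` (abc-iut-f-066 gen 6, follow-on «P13viii-TWO-VERTEX»), part III
over `TwoTripodNodalEdgePairs.lean` (where `D_ε ∩ γD_{ε'}γ⁻¹` is computed for all twenty ordered pairs of distinct edges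
and every `γ ∈ Π_𝔾`: `I_v ∩ Z(γ)` at a common vertex, `1` otherwise).  At `M.dpsc` (typer of record abc-iut-L4-t6,
`DPSCIndexData.Prop_1_3_viii'`, `InertiaGroupsScope.lean`):

* `DEdge_inf_conj_inf_PiG_eq_bot` — **the `Π_𝔾`-clause for EVERY pair of distinct edges and EVERY `γ ∈ Π_𝔾`**,
  no hypothesis; `DEdge_inf_conj_eq_Iv_of_mem_vertSub` — **the «Moreover» identity for every `γ ∈ Π_v`**
  (`D_ε ∩ γD_{ε'}γ⁻¹ = I_v` EXACTLY, both vertices, all six same-vertex pairs), no hypothesis; situation (2) is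
  INHABITED (`situation_two_inhabited`);
* `prop_1_3_viii'_dpsc_of_keyGen` — **the typed `Prop_1_3_viii'` at the two-vertex datum MODULO ONE named input
  «KeyGen»: an element of `Π_𝔾` commuting with a NON-TRIVIAL element of `I_{v_A} = T` (resp. `I_{v_B} = U`) lies in
  `Π_{v_A}` (resp. `Π_{v_B}`)** — for the elements `t₀ⁿ`, `u₀ⁿ` (`n ≥ 1`), which generate the open subgroups of
  `I_v ≅ Ẑ^Σ`, this IS abc-iut-f-066's KEY₂ (`mem_vertGpA_of_commute_pow_T`, `mem_vertGpB_of_commute_pow_U`, p482872);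
  the residual is the case of elements generating a non-open closed subgroup (vacuous when `Σ = {ℓ}`):
  `keyGenT_of_pow`, `keyGenU_of_pow` record the proved instances.
HONEST FRAMING: classical profinite group theory at a constructed model (constructed ≠ geometric); typed ≠ proved for the
residual KeyGen; nothing here bears on [IUTchIII] Cor 3.12; no side taken.
-/

noncomputable section

open scoped Pointwise

namespace Literature.AnabelianGeometry.AbsoluteAnabelian.AbsTopII.TwoTripodNodal.Model

open Literature.AnabelianGeometry.SemiGraphs
open Literature.AnabelianGeometry.SemiGraphs.SemiGraphOfAnabelioids.IsProSigmaCompletion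
open Literature.AnabelianGeometry.Anabelioids (IsSigmaInteger)
open Literature.GroupTheory.CombinatorialGroupTheory
open Literature.GroupTheory.CombinatorialGroupTheory.PuncturedSurfaceGroup
open _root_.Topology

variable {Sigma : Set ℕ} (M : Model Sigma)

/-! ### The `Π_𝔾`-clause and the «Moreover» at `γ ∈ Π_v`, no hypothesis -/

/-- `(S ∩ Z(γ)) ∩ Π_𝔾 = 1` for a section `S`. [cite: MochizukiAbsTopII2013, Prop 1.3 (viii) p.12] -/
theorem inf_centralizer_inf_PiG_eq_bot {S : Subgroup M.P} (hSbot : S ⊓ M.PiG = ⊥) (γ : M.P) :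
    (S ⊓ Subgroup.centralizer ({γ} : Set M.P)) ⊓ M.PiG = ⊥ := by
  rw [eq_bot_iff, ← hSbot]
  exact fun x hx => ⟨hx.1.1, hx.2⟩

/-- `S ∩ Z(γ) = S` when `S` centralises `K ∋ γ`. [cite: MochizukiAbsTopII2013, Prop 1.3 (viii) p.12] -/
theorem inf_centralizer_eq_of_mem {S K : Subgroup M.P} (hSK : S ≤ Subgroup.centralizer (K : Set M.P)) {γ : M.P}
    (hγ : γ ∈ K) : S ⊓ Subgroup.centralizer ({γ} : Set M.P) = S := by
  refine le_antisymm inf_le_left fun s hs => Subgroup.mem_inf.mpr ⟨hs, ?_⟩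
  rw [Subgroup.mem_centralizer_singleton_iff]
  exact (Subgroup.mem_centralizer_iff.mp (hSK hs) γ hγ).symm

/-- If `S ∩ Z(γ) ≠ 1` and «KeyGen» holds for `S` and `K`, then `S ∩ Z(γ) = S`. [cite: MochizukiAbsTopII2013, Prop 1.3 (viii) p.12] -/
theorem inf_centralizer_eq_of_ne_bot {S K : Subgroup M.P} (hSK : S ≤ Subgroup.centralizer (K : Set M.P))
    (hkey : ∀ s ∈ S, s ≠ 1 → ∀ γ ∈ M.PiG, γ * s = s * γ → γ ∈ K) {γ : M.P} (hγ : γ ∈ M.PiG)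
    (hne : S ⊓ Subgroup.centralizer ({γ} : Set M.P) ≠ ⊥) : S ⊓ Subgroup.centralizer ({γ} : Set M.P) = S := by
  obtain ⟨⟨s, hs⟩, hs1⟩ := (Subgroup.ne_bot_iff_exists_ne_one).mp hne
  have hs1' : s ≠ 1 := fun h => hs1 (Subtype.ext h)
  obtain ⟨hsS, hsC⟩ := Subgroup.mem_inf.mp hs
  have hsγ : s * γ = γ * s := Subgroup.mem_centralizer_singleton_iff.mp hsC
  exact M.inf_centralizer_eq_of_mem hSK (hkey s hsS hs1' γ hγ hsγ.symm)

/-- `T ≠ 1` (`T ≅ Ẑ^Σ` has an open subgroup of index `p ∈ Σ`). [cite: MochizukiAbsTopII2013, Prop 1.3 (iii) p.11] -/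
theorem T_ne_bot (hne : Sigma.Nonempty) (hprime : ∀ p ∈ Sigma, p.Prime) : M.T ≠ ⊥ := by
  intro h
  obtain ⟨p, hp⟩ := hne
  have hpS : IsSigmaInteger Sigma p := by simpa using isSigmaInteger_prime_pow (hprime p hp) hp 1
  obtain ⟨H, -, hH⟩ := (M.isFreeProSigmaCyclic_T.isOpen_index_iff p).mpr hpS
  have htop : H = ⊤ := by
    ext x
    simp only [Subgroup.mem_top, iff_true]
    have hx : (x : M.P) ∈ (⊥ : Subgroup M.P) := h ▸ x.2
    have hx1 : x = 1 := Subtype.ext (Subgroup.mem_bot.mp hx)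
    rw [hx1]; exact H.one_mem
  rw [htop, Subgroup.index_top] at hH
  exact (hprime p hp).one_lt.ne hH

/-- `Z_P(1) = P`. [cite: MochizukiAbsTopII2013, Prop 1.3 (viii) p.12] -/
theorem centralizer_one_eq_top : Subgroup.centralizer ({(1 : M.P)} : Set M.P) = ⊤ :=
  eq_top_iff.mpr fun x _ => Subgroup.mem_centralizer_singleton_iff.mpr (by rw [mul_one, one_mul])

/-- The four cusps of the datum, with literal indices. [cite: MochizukiAbsTopII2013, Ex 1.1 (ii) p.9] -/
theorem cusp_cases (hne : Sigma.Nonempty) (hprime : ∀ p ∈ Sigma, p.Prime) (e : (M.dpsc hne hprime).Cusp) :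
    e = ⟨(0 : Fin 4)⟩ ∨ e = ⟨(1 : Fin 4)⟩ ∨ e = ⟨(2 : Fin 4)⟩ ∨ e = ⟨(3 : Fin 4)⟩ := by
  rcases e with ⟨j⟩
  fin_cases j
  · exact Or.inl rfl
  · exact Or.inr (Or.inl rfl)
  · exact Or.inr (Or.inr (Or.inl rfl))
  · exact Or.inr (Or.inr (Or.inr rfl))

/-- The datum has ONE node. [cite: MochizukiAbsTopII2013, Ex 1.1 (ii) p.9] -/
theorem node_eq (hne : Sigma.Nonempty) (hprime : ∀ p ∈ Sigma, p.Prime) (e e' : (M.dpsc hne hprime).Node) : e = e' := by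
  rcases e with ⟨⟨⟩⟩; rcases e' with ⟨⟨⟩⟩; rfl

/-- A cusp abuts only to its own vertex (`c₁, c₂ ↦ v_A`, `c₃, c₀ ↦ v_B`). [cite: MochizukiAbsTopII2013, Ex 1.1 (ii) p.9] -/
theorem not_edgeAbuts_cusp (hne : Sigma.Nonempty) (hprime : ∀ p ∈ Sigma, p.Prime) (j : Fin 4) (v : Fin 2) (h : (![(1 : Fin 2), 0, 0, 1] : Fin 4 → Fin 2) j ≠ v) :
    ¬ (M.dpsc hne hprime).EdgeAbuts (Sum.inr ⟨j⟩) ⟨v⟩ :=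
  fun hev => h (congrArg ULift.down hev)

/-- **The `Π_𝔾`-clause of Prop 1.3 (viii) for EVERY pair of distinct edges and EVERY `γ ∈ Π_𝔾`, no hypothesis**:
`D_ε ∩ γ D_{ε'} γ⁻¹ ∩ Π_𝔾 = 1`. [cite: MochizukiAbsTopII2013, Prop 1.3 (viii) p.12] -/
theorem DEdge_inf_conj_inf_PiG_eq_bot (hne : Sigma.Nonempty) (hprime : ∀ p ∈ Sigma, p.Prime) (e e' : (M.dpsc hne hprime).Edge) (hee' : e ≠ e')
    {γ : (M.dpsc hne hprime).PiH} (hγ : γ ∈ M.PiG) :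
    (M.dpsc hne hprime).DEdge e ⊓ MulAut.conj γ • (M.dpsc hne hprime).DEdge e' ⊓ M.PiG = ⊥ := by
  have hT := fun γ : M.P => M.inf_centralizer_inf_PiG_eq_bot M.T_inf_PiG γ
  have hU := fun γ : M.P => M.inf_centralizer_inf_PiG_eq_bot (M.U_inf_PiG hne hprime) γ
  rcases e with e₀ | c <;> rcases e' with e₀' | c'
  · exact absurd (congrArg Sum.inl (M.node_eq hne hprime e₀ e₀')) hee'
  · rcases M.cusp_cases hne hprime c' with rfl | rfl | rfl | rfl <;> simp only [DPSCIndexData.DEdge]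
    · rw [M.De_inf_conj_Dc0 hne hprime _ hγ]; exact hU _
    · rw [M.De_inf_conj_Dc1 hne hprime _ hγ]; exact hT _
    · rw [M.De_inf_conj_Dc2 hne hprime _ hγ]; exact hT _
    · rw [M.De_inf_conj_Dc3 hne hprime _ hγ]; exact hU _
  · rcases M.cusp_cases hne hprime c with rfl | rfl | rfl | rfl <;> simp only [DPSCIndexData.DEdge]
    · rw [M.Dc0_inf_conj_De hne hprime _ hγ]; exact hU _
    · rw [M.Dc1_inf_conj_De hne hprime _ hγ]; exact hT _
    · rw [M.Dc2_inf_conj_De hne hprime _ hγ]; exact hT _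
    · rw [M.Dc3_inf_conj_De hne hprime _ hγ]; exact hU _
  · rcases M.cusp_cases hne hprime c with rfl | rfl | rfl | rfl <;>
      rcases M.cusp_cases hne hprime c' with rfl | rfl | rfl | rfl <;> simp only [DPSCIndexData.DEdge]
    · exact absurd rfl hee'
    · rw [M.Dc0_inf_conj_Dc1_eq_bot hne hprime hγ, bot_inf_eq]
    · rw [M.Dc0_inf_conj_Dc2_eq_bot hne hprime hγ, bot_inf_eq]
    · rw [M.Dc0_inf_conj_Dc3 hne hprime hγ]; exact hU _
    · rw [M.Dc1_inf_conj_Dc0_eq_bot hne hprime hγ, bot_inf_eq]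
    · exact absurd rfl hee'
    · rw [M.Dc1_inf_conj_Dc2 hne hprime hγ]; exact hT _
    · rw [M.Dc1_inf_conj_Dc3_eq_bot hne hprime hγ, bot_inf_eq]
    · rw [M.Dc2_inf_conj_Dc0_eq_bot hne hprime hγ, bot_inf_eq]
    · rw [M.Dc2_inf_conj_Dc1 hne hprime hγ]; exact hT _
    · exact absurd rfl hee'
    · rw [M.Dc2_inf_conj_Dc3_eq_bot hne hprime hγ, bot_inf_eq]
    · rw [M.Dc3_inf_conj_Dc0 hne hprime hγ]; exact hU _
    · rw [M.Dc3_inf_conj_Dc1_eq_bot hne hprime hγ, bot_inf_eq]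
    · rw [M.Dc3_inf_conj_Dc2_eq_bot hne hprime hγ, bot_inf_eq]
    · exact absurd rfl hee'

/-- **Situation (2) is INHABITED at the two-vertex datum**: the node and the cusp `c₁` are distinct edges at `v_A` and
`D_e ∩ D_{c₁} ∩ Π_I = I_{v_A} ≠ 1`. [cite: MochizukiAbsTopII2013, Prop 1.3 (viii) p.12] -/
theorem situation_two_inhabited (hne : Sigma.Nonempty) (hprime : ∀ p ∈ Sigma, p.Prime) (e : (M.dpsc hne hprime).Node) :
    (M.dpsc hne hprime).DEdge (Sum.inl e) ⊓ MulAut.conj (1 : (M.dpsc hne hprime).PiH) •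
        (M.dpsc hne hprime).DEdge (Sum.inr ⟨(1 : Fin 4)⟩) ⊓ (M.dpsc hne hprime).PiI =
      (M.dpsc hne hprime).Iv ⟨(0 : Fin 2)⟩ ∧ (M.dpsc hne hprime).Iv ⟨(0 : Fin 2)⟩ ≠ ⊥ := by
  constructor
  · simp only [DPSCIndexData.DEdge]
    have h := M.De_inf_conj_Dc1 hne hprime e (γ := (1 : (M.dpsc hne hprime).PiH)) M.PiG.one_mem
    rw [dpsc_PiI, inf_top_eq, h, Iv_eq_T]
    have h1 : Subgroup.centralizer ({(1 : (M.dpsc hne hprime).PiH)} : Set M.P) = ⊤ := M.centralizer_one_eq_top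
    rw [h1, inf_top_eq]
  · rw [Iv_eq_T]; exact M.T_ne_bot hne hprime

/-- **The «Moreover» identity for every `γ ∈ Π_v`, no hypothesis**: for distinct edges `ε, ε'` at the vertex `v` and
`γ ∈ Π_v`, `D_ε ∩ γ D_{ε'} γ⁻¹ ∩ Π_I = I_v` EXACTLY (twelve ordered pairs; `I_{v_A} = T`, `I_{v_B} = U`).
[cite: MochizukiAbsTopII2013, Prop 1.3 (viii) p.12] -/
theorem DEdge_inf_conj_eq_Iv_of_mem_vertSub (hne : Sigma.Nonempty) (hprime : ∀ p ∈ Sigma, p.Prime) (e e' : (M.dpsc hne hprime).Edge) (hee' : e ≠ e') (v : (M.dpsc hne hprime).Vert)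
    (hev : (M.dpsc hne hprime).EdgeAbuts e v) (he'v : (M.dpsc hne hprime).EdgeAbuts e' v)
    {γ : (M.dpsc hne hprime).PiH} (hγ : γ ∈ (M.dpsc hne hprime).vertSub v) :
    (M.dpsc hne hprime).DEdge e ⊓ MulAut.conj γ • (M.dpsc hne hprime).DEdge e' ⊓ (M.dpsc hne hprime).PiI =
      (M.dpsc hne hprime).Iv v := by
  have hγG : γ ∈ M.PiG := by
    have h := (M.dpsc hne hprime).vertSub_le v hγ
    rwa [dpsc_PiG] at h
  have nab := M.not_edgeAbuts_cusp hne hprime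
  rw [dpsc_PiI, inf_top_eq]
  rcases M.vert_cases hne hprime v with rfl | rfl
  · -- `v = v_A`: edges `e`, `c₁`, `c₂`; `γ ∈ Π_{v_A}` centralises `T`
    have hT : M.T ⊓ Subgroup.centralizer ({γ} : Set M.P) = M.T :=
      M.inf_centralizer_eq_of_mem M.T_le_centralizer_vertGpA (by rwa [vertSub_zero] at hγ)
    rw [Iv_eq_T]
    rcases e with e₀ | c <;> rcases e' with e₀' | c'
    · exact absurd (congrArg Sum.inl (M.node_eq hne hprime e₀ e₀')) hee'
    · rcases M.cusp_cases hne hprime c' with rfl | rfl | rfl | rfl <;> simp only [DPSCIndexData.DEdge]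
      · exact absurd he'v (nab 0 0 (by decide))
      · rw [M.De_inf_conj_Dc1 hne hprime _ hγG, hT]
      · rw [M.De_inf_conj_Dc2 hne hprime _ hγG, hT]
      · exact absurd he'v (nab 3 0 (by decide))
    · rcases M.cusp_cases hne hprime c with rfl | rfl | rfl | rfl <;> simp only [DPSCIndexData.DEdge]
      · exact absurd hev (nab 0 0 (by decide))
      · rw [M.Dc1_inf_conj_De hne hprime _ hγG, hT]
      · rw [M.Dc2_inf_conj_De hne hprime _ hγG, hT]
      · exact absurd hev (nab 3 0 (by decide))
    · rcases M.cusp_cases hne hprime c with rfl | rfl | rfl | rfl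
      · exact absurd hev (nab 0 0 (by decide))
      · rcases M.cusp_cases hne hprime c' with rfl | rfl | rfl | rfl <;> simp only [DPSCIndexData.DEdge]
        · exact absurd he'v (nab 0 0 (by decide))
        · exact absurd rfl hee'
        · rw [M.Dc1_inf_conj_Dc2 hne hprime hγG, hT]
        · exact absurd he'v (nab 3 0 (by decide))
      · rcases M.cusp_cases hne hprime c' with rfl | rfl | rfl | rfl <;> simp only [DPSCIndexData.DEdge]
        · exact absurd he'v (nab 0 0 (by decide))
        · rw [M.Dc2_inf_conj_Dc1 hne hprime hγG, hT]
        · exact absurd rfl hee'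
        · exact absurd he'v (nab 3 0 (by decide))
      · exact absurd hev (nab 3 0 (by decide))
  · -- `v = v_B`: edges `e`, `c₃`, `c₀`; `γ ∈ Π_{v_B}` centralises `U`
    have hU : M.U ⊓ Subgroup.centralizer ({γ} : Set M.P) = M.U :=
      M.inf_centralizer_eq_of_mem M.U_le_centralizer_vertGpB (by rwa [vertSub_one] at hγ)
    rw [Iv_eq_U]
    rcases e with e₀ | c <;> rcases e' with e₀' | c'
    · exact absurd (congrArg Sum.inl (M.node_eq hne hprime e₀ e₀')) hee'
    · rcases M.cusp_cases hne hprime c' with rfl | rfl | rfl | rfl <;> simp only [DPSCIndexData.DEdge]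
      · rw [M.De_inf_conj_Dc0 hne hprime _ hγG, hU]
      · exact absurd he'v (nab 1 1 (by decide))
      · exact absurd he'v (nab 2 1 (by decide))
      · rw [M.De_inf_conj_Dc3 hne hprime _ hγG, hU]
    · rcases M.cusp_cases hne hprime c with rfl | rfl | rfl | rfl <;> simp only [DPSCIndexData.DEdge]
      · rw [M.Dc0_inf_conj_De hne hprime _ hγG, hU]
      · exact absurd hev (nab 1 1 (by decide))
      · exact absurd hev (nab 2 1 (by decide))
      · rw [M.Dc3_inf_conj_De hne hprime _ hγG, hU]
    · rcases M.cusp_cases hne hprime c with rfl | rfl | rfl | rfl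
      · rcases M.cusp_cases hne hprime c' with rfl | rfl | rfl | rfl <;> simp only [DPSCIndexData.DEdge]
        · exact absurd rfl hee'
        · exact absurd he'v (nab 1 1 (by decide))
        · exact absurd he'v (nab 2 1 (by decide))
        · rw [M.Dc0_inf_conj_Dc3 hne hprime hγG, hU]
      · exact absurd hev (nab 1 1 (by decide))
      · exact absurd hev (nab 2 1 (by decide))
      · rcases M.cusp_cases hne hprime c' with rfl | rfl | rfl | rfl <;> simp only [DPSCIndexData.DEdge]
        · rw [M.Dc3_inf_conj_Dc0 hne hprime hγG, hU]
        · exact absurd he'v (nab 1 1 (by decide))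
        · exact absurd he'v (nab 2 1 (by decide))
        · exact absurd rfl hee'

/-! ### The typed `Prop_1_3_viii'`, modulo KeyGen -/

/-- **[AbsTopII] Prop 1.3 (viii) AS TYPED (`Prop_1_3_viii'`) at the two-vertex nodal datum, MODULO «KeyGen»** — the one
named input: an element of `Π_𝔾` commuting with a non-trivial element of `I_{v_A} = T` (resp. `I_{v_B} = U`) lies in
`Π_{v_A}` (resp. `Π_{v_B}`).  Everything else (the dichotomy, the `Π_𝔾`-clause, the identification of
`D_ε ∩ γD_{ε'}γ⁻¹` with `I_v ∩ Z(γ)`) is unconditional; the «Moreover» conjugate is `h = 1`.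
[cite: MochizukiAbsTopII2013, Prop 1.3 (viii) p.12] -/
theorem prop_1_3_viii'_dpsc_of_keyGen (hne : Sigma.Nonempty) (hprime : ∀ p ∈ Sigma, p.Prime)
    (hT : ∀ s ∈ M.T, s ≠ 1 → ∀ γ ∈ M.PiG, γ * s = s * γ → γ ∈ (M.vertGpA).map M.PiG.subtype)
    (hU : ∀ s ∈ M.U, s ≠ 1 → ∀ γ ∈ M.PiG, γ * s = s * γ → γ ∈ (M.vertGpB).map M.PiG.subtype) :
    Literature.AnabelianGeometry.AbsoluteAnabelian.AbsTopII.DPSCIndexData.Prop_1_3_viii' (M.dpsc hne hprime) := by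
  intro e e' γ hγ hX
  rw [dpsc_PiG] at hγ
  by_cases hee' : e = e'
  · exact Or.inl hee'
  right
  refine ⟨hee', ?_⟩
  rw [dpsc_PiI, inf_top_eq] at hX
  simp only [dpsc_PiI, inf_top_eq, dpsc_PiG]
  have keyT : ∀ {γ' : M.P}, γ' ∈ M.PiG → M.T ⊓ Subgroup.centralizer ({γ'} : Set M.P) ≠ ⊥ →
      M.T ⊓ Subgroup.centralizer ({γ'} : Set M.P) = M.T :=
    fun hγ' h => M.inf_centralizer_eq_of_ne_bot M.T_le_centralizer_vertGpA hT hγ' h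
  have keyU : ∀ {γ' : M.P}, γ' ∈ M.PiG → M.U ⊓ Subgroup.centralizer ({γ'} : Set M.P) ≠ ⊥ →
      M.U ⊓ Subgroup.centralizer ({γ'} : Set M.P) = M.U :=
    fun hγ' h => M.inf_centralizer_eq_of_ne_bot M.U_le_centralizer_vertGpB hU hγ' h
  have abutsA : ∀ e₀ : (M.dpsc hne hprime).Node, (M.dpsc hne hprime).EdgeAbuts (Sum.inl e₀) ⟨(0 : Fin 2)⟩ :=
    fun e₀ => M.nodeAbuts_dpsc hne hprime e₀ _
  have abutsB : ∀ e₀ : (M.dpsc hne hprime).Node, (M.dpsc hne hprime).EdgeAbuts (Sum.inl e₀) ⟨(1 : Fin 2)⟩ :=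
    fun e₀ => M.nodeAbuts_dpsc hne hprime e₀ _
  have cT : ∀ γ' : M.P, (M.T ⊓ Subgroup.centralizer ({γ'} : Set M.P)) ⊓ M.PiG = ⊥ :=
    fun γ' => M.inf_centralizer_inf_PiG_eq_bot M.T_inf_PiG γ'
  have cU : ∀ γ' : M.P, (M.U ⊓ Subgroup.centralizer ({γ'} : Set M.P)) ⊓ M.PiG = ⊥ :=
    fun γ' => M.inf_centralizer_inf_PiG_eq_bot (M.U_inf_PiG hne hprime) γ'
  rcases e with e₀ | c <;> rcases e' with e₀' | c'
  · exact absurd (congrArg Sum.inl (M.node_eq hne hprime e₀ e₀')) hee'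
  · rcases M.cusp_cases hne hprime c' with rfl | rfl | rfl | rfl <;> simp only [DPSCIndexData.DEdge] at hX ⊢
    · rw [M.De_inf_conj_Dc0 hne hprime _ hγ] at hX ⊢
      exact ⟨⟨(1 : Fin 2)⟩, abutsB _, rfl, cU _, 1, M.PiG.one_mem, by rw [map_one, one_smul, Iv_eq_U]; exact (keyU hγ hX).symm⟩
    · rw [M.De_inf_conj_Dc1 hne hprime _ hγ] at hX ⊢
      exact ⟨⟨(0 : Fin 2)⟩, abutsA _, rfl, cT _, 1, M.PiG.one_mem, by rw [map_one, one_smul, Iv_eq_T]; exact (keyT hγ hX).symm⟩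
    · rw [M.De_inf_conj_Dc2 hne hprime _ hγ] at hX ⊢
      exact ⟨⟨(0 : Fin 2)⟩, abutsA _, rfl, cT _, 1, M.PiG.one_mem, by rw [map_one, one_smul, Iv_eq_T]; exact (keyT hγ hX).symm⟩
    · rw [M.De_inf_conj_Dc3 hne hprime _ hγ] at hX ⊢
      exact ⟨⟨(1 : Fin 2)⟩, abutsB _, rfl, cU _, 1, M.PiG.one_mem, by rw [map_one, one_smul, Iv_eq_U]; exact (keyU hγ hX).symm⟩
  · rcases M.cusp_cases hne hprime c with rfl | rfl | rfl | rfl <;> simp only [DPSCIndexData.DEdge] at hX ⊢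
    · rw [M.Dc0_inf_conj_De hne hprime _ hγ] at hX ⊢
      exact ⟨⟨(1 : Fin 2)⟩, rfl, abutsB _, cU _, 1, M.PiG.one_mem, by rw [map_one, one_smul, Iv_eq_U]; exact (keyU hγ hX).symm⟩
    · rw [M.Dc1_inf_conj_De hne hprime _ hγ] at hX ⊢
      exact ⟨⟨(0 : Fin 2)⟩, rfl, abutsA _, cT _, 1, M.PiG.one_mem, by rw [map_one, one_smul, Iv_eq_T]; exact (keyT hγ hX).symm⟩
    · rw [M.Dc2_inf_conj_De hne hprime _ hγ] at hX ⊢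
      exact ⟨⟨(0 : Fin 2)⟩, rfl, abutsA _, cT _, 1, M.PiG.one_mem, by rw [map_one, one_smul, Iv_eq_T]; exact (keyT hγ hX).symm⟩
    · rw [M.Dc3_inf_conj_De hne hprime _ hγ] at hX ⊢
      exact ⟨⟨(1 : Fin 2)⟩, rfl, abutsB _, cU _, 1, M.PiG.one_mem, by rw [map_one, one_smul, Iv_eq_U]; exact (keyU hγ hX).symm⟩
  · rcases M.cusp_cases hne hprime c with rfl | rfl | rfl | rfl <;>
      rcases M.cusp_cases hne hprime c' with rfl | rfl | rfl | rfl <;> simp only [DPSCIndexData.DEdge] at hX ⊢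
    · exact absurd rfl hee'
    · exact absurd (M.Dc0_inf_conj_Dc1_eq_bot hne hprime hγ) hX
    · exact absurd (M.Dc0_inf_conj_Dc2_eq_bot hne hprime hγ) hX
    · rw [M.Dc0_inf_conj_Dc3 hne hprime hγ] at hX ⊢
      exact ⟨⟨(1 : Fin 2)⟩, rfl, rfl, cU _, 1, M.PiG.one_mem, by rw [map_one, one_smul, Iv_eq_U]; exact (keyU hγ hX).symm⟩
    · exact absurd (M.Dc1_inf_conj_Dc0_eq_bot hne hprime hγ) hX
    · exact absurd rfl hee'
    · rw [M.Dc1_inf_conj_Dc2 hne hprime hγ] at hX ⊢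
      exact ⟨⟨(0 : Fin 2)⟩, rfl, rfl, cT _, 1, M.PiG.one_mem, by rw [map_one, one_smul, Iv_eq_T]; exact (keyT hγ hX).symm⟩
    · exact absurd (M.Dc1_inf_conj_Dc3_eq_bot hne hprime hγ) hX
    · exact absurd (M.Dc2_inf_conj_Dc0_eq_bot hne hprime hγ) hX
    · rw [M.Dc2_inf_conj_Dc1 hne hprime hγ] at hX ⊢
      exact ⟨⟨(0 : Fin 2)⟩, rfl, rfl, cT _, 1, M.PiG.one_mem, by rw [map_one, one_smul, Iv_eq_T]; exact (keyT hγ hX).symm⟩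
    · exact absurd rfl hee'
    · exact absurd (M.Dc2_inf_conj_Dc3_eq_bot hne hprime hγ) hX
    · rw [M.Dc3_inf_conj_Dc0 hne hprime hγ] at hX ⊢
      exact ⟨⟨(1 : Fin 2)⟩, rfl, rfl, cU _, 1, M.PiG.one_mem, by rw [map_one, one_smul, Iv_eq_U]; exact (keyU hγ hX).symm⟩
    · exact absurd (M.Dc3_inf_conj_Dc1_eq_bot hne hprime hγ) hX
    · exact absurd (M.Dc3_inf_conj_Dc2_eq_bot hne hprime hγ) hX
    · exact absurd rfl hee'

/-- **The instances of «KeyGen» already PROVED (abc-iut-f-066 KEY₂, p482872)**: the hypothesis of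
`prop_1_3_viii'_dpsc_of_keyGen` holds for the elements `t₀ⁿ`, `n ≥ 1`, of `T` — which topologically generate its open
subgroups. [cite: MochizukiAbsTopII2013, Prop 1.3 (v) p.12] -/
theorem keyGenT_of_pow (hne : Sigma.Nonempty) (hprime : ∀ p ∈ Sigma, p.Prime) {n : ℕ} (hn : 0 < n) {γ : M.P} (hγ : γ ∈ M.PiG)
    (h : γ * M.ι (SemidirectProduct.inr (Multiplicative.ofAdd (1 : ℤ))) ^ n =
      M.ι (SemidirectProduct.inr (Multiplicative.ofAdd (1 : ℤ))) ^ n * γ) :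
    γ ∈ (M.vertGpA).map M.PiG.subtype :=
  M.mem_vertGpA_of_commute_pow_T hne hprime hγ hn h

/-- The `U`-companion of `keyGenT_of_pow`: «KeyGen» holds for the elements `u₀ⁿ`, `n ≥ 1`, of `U`.
[cite: MochizukiAbsTopII2013, Prop 1.3 (v) p.12] -/
theorem keyGenU_of_pow (hne : Sigma.Nonempty) (hprime : ∀ p ∈ Sigma, p.Prime) {n : ℕ} (hn : 0 < n) {γ : M.P} (hγ : γ ∈ M.PiG)
    (h : γ * M.ι (SemidirectProduct.inl (c 1 * c 2 : PuncturedSurfaceGroup 0 4)⁻¹ *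
        SemidirectProduct.inr (Multiplicative.ofAdd (1 : ℤ))) ^ n =
      M.ι (SemidirectProduct.inl (c 1 * c 2 : PuncturedSurfaceGroup 0 4)⁻¹ *
        SemidirectProduct.inr (Multiplicative.ofAdd (1 : ℤ))) ^ n * γ) :
    γ ∈ (M.vertGpB).map M.PiG.subtype :=
  M.mem_vertGpB_of_commute_pow_U hne hprime hγ hn h


end Literature.AnabelianGeometry.AbsoluteAnabelian.AbsTopII.TwoTripodNodal.Model

end
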